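import Summits.ABC.ABC.Theorems.FeketeScalesTargetOfSubPowerSlack
import Literature.Barriers.ABC.ExplicitABCQualityFloor

/-!
# Route FeketeScales — crux `Target` (stmt-ABC-2159): the ω-split line (glue)

Line `SketchIdeator2` of `Cruxes/Target/` (idea card `polyconstant-omega-split`, and the same cut as
card `omega-graded-slack`): the crux's own sub-power tolerance `exp(A (log N)^θ)`, `θ < 1`, splits
the abc triples at `ω(abc) = (log N)^{θ'}` (`N = rad(abc)`, `0 < θ' < θ < 1`):

* FEW primes, `ω(abc) ≤ (log N)^{θ'}`: Baker's refinement `c < κ N (log N)^ω / ω!` with SOME constant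
  `κ` (`∃ κ, Literature.Barriers.ABC.BakerShapeExplicitABC κ`, which is literally route LogCardinality's
  item `BakerRefinement`, stmt-ABC-1756) is already sub-power: with `ε = (log N)^{θ'-1}`,
  `(log N)^ω/ω! ≤ e^{ε log N} ε^{-ω}` gives excess `≤ log κ + (log N)^{θ'} + ω (1-θ') log log N = O((log N)^θ)`
  (`Target.smallOmega_bound`, the real-variable core);
* MANY primes, `ω(abc) > (log N)^{θ'}` (the "ultra-composite tail"): a sub-power excess
  `c < N exp(A (log N)^θ)` is ASSUMED — the line's conjecture-grade stub.

`Target.subPowerSlack_of_bakerShape_of_tail` composes the two regimes into the pointwise sub-power slack,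
and `Target.target_of_bakerShape_of_tail` concludes the crux `Target` by name through
`Target.target_of_subPowerSlack`.  Both hypotheses are stated in the tree's vocabulary and taken as
hypotheses (the theorem is an implication; it closes nothing).  Proof idea from
`Cruxes/Target/SketchIdeator2.lean` (planner-cruxidea-stmt-ABC-2159-2-0), re-proved here directly from
Baker's shape.  Helper file `--supports stmt-ABC-2159`.
-/

-- `Summit.<Summit>.<Problem>` is the mandated summit-side namespace (CONVENTIONS §2); for the
-- single-conjunct summit `ABC` the two coincide, so the duplicate `ABC.ABC` is deliberate.
set_option linter.dupNamespace false

namespace Summit.ABC.ABC.Theorems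

open Literature.NumberTheory.DiophantineGeometry
open Summit.ABC.ABC.Theses.FeketeScales

/-- **Real-variable core of the few-primes regime.**  For `κ > 0`, `0 < θ' < θ < 1`, `N ≥ 2` and a
natural `w ≤ (log N)^{θ'}`, Baker's shape `c < κ N (log N)^w / w!` gives the sub-power excess
`c < N exp(A₁ (log N)^θ)` with `A₁ = (|log κ| + 1)/(log 2)^θ + |log κ| + 1 + 1/(θ - θ')`
(for `log N ≥ 1` via `(log N)^w/w! ≤ e^{εL} ε^{-w}`, `ε = L^{θ'-1}`, and `log L ≤ L^{θ-θ'}/(θ-θ')`;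
for `log N < 1` via `L^w/w! ≤ e^L < e`). [folklore] -/
theorem Target.smallOmega_bound {κ θ' θ N c : ℝ} {w : ℕ} (hκ : 0 < κ) (h0 : 0 < θ') (h1 : θ' < θ)
    (h2 : θ < 1) (hN : 2 ≤ N) (hw : (w : ℝ) ≤ Real.log N ^ θ')
    (hc : c < κ * N * Real.log N ^ w / (w.factorial : ℝ)) :
    c < N * Real.exp (((|Real.log κ| + 1) / Real.log 2 ^ θ + |Real.log κ| + 1 + 1 / (θ - θ'))
      * Real.log N ^ θ) := by
  have hθ0 : 0 < θ := h0.trans h1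
  have hgap : 0 < θ - θ' := by linarith
  have hN0 : 0 < N := by linarith
  have hlog2 : 0 < Real.log 2 := Real.log_pos one_lt_two
  set L : ℝ := Real.log N with hL
  have hL2 : Real.log 2 ≤ L := Real.log_le_log two_pos hN
  have hL0 : 0 < L := hlog2.trans_le hL2
  have hLθ0 : 0 < L ^ θ := Real.rpow_pos_of_pos hL0 _
  have hl2θ : 0 < Real.log 2 ^ θ := Real.rpow_pos_of_pos hlog2 _
  have hLθ2 : Real.log 2 ^ θ ≤ L ^ θ := Real.rpow_le_rpow hlog2.le hL2 hθ0.le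
  have hfact : (0 : ℝ) < (w.factorial : ℝ) := by exact_mod_cast Nat.factorial_pos w
  set K : ℝ := |Real.log κ| with hK
  have hK0 : 0 ≤ K := abs_nonneg _
  have hlogκ : Real.log κ ≤ K := le_abs_self _
  set A₁ : ℝ := (K + 1) / Real.log 2 ^ θ + K + 1 + 1 / (θ - θ') with hA₁
  have hq0 : 0 ≤ (K + 1) / Real.log 2 ^ θ := div_nonneg (by linarith) hl2θ.le
  have hg0 : 0 ≤ 1 / (θ - θ') := div_nonneg zero_le_one hgap.le
  -- rewrite Baker's bound as `c < N * (κ * (L^w / w!))`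
  have hc' : c < N * (κ * (L ^ w / (w.factorial : ℝ))) := by
    calc c < κ * N * L ^ w / (w.factorial : ℝ) := hc
      _ = N * (κ * (L ^ w / (w.factorial : ℝ))) := by ring
  -- it suffices to bound the bracket by `exp(A₁ L^θ)`
  suffices hbr : κ * (L ^ w / (w.factorial : ℝ)) ≤ Real.exp (A₁ * L ^ θ) by
    calc c < N * (κ * (L ^ w / (w.factorial : ℝ))) := hc'
      _ ≤ N * Real.exp (A₁ * L ^ θ) := mul_le_mul_of_nonneg_left hbr hN0.le
  rcases le_or_gt 1 L with hL1 | hL1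
  · -- `L ≥ 1`: `ε := exp((θ'-1) log L) = L^{θ'-1}`
    have hlogL : 0 ≤ Real.log L := Real.log_nonneg hL1
    set ε : ℝ := Real.exp ((θ' - 1) * Real.log L) with hε
    have hε0 : 0 < ε := Real.exp_pos _
    have hεL : ε * L = L ^ θ' := by
      rw [hε, Real.rpow_def_of_pos hL0, mul_comm (Real.log L) θ']
      conv_lhs => rw [show L = Real.exp (Real.log L) from (Real.exp_log hL0).symm]
      rw [Real.log_exp, ← Real.exp_add]; ring_nf
    have hpf : (ε * L) ^ w / (w.factorial : ℝ) ≤ Real.exp (ε * L) :=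
      Real.pow_div_factorial_le_exp (ε * L) (by positivity) w
    have hεw : (0 : ℝ) < ε ^ w := pow_pos hε0 w
    -- `L^w / w! ≤ exp(εL) / ε^w = exp(L^θ' + w (1-θ') log L)`
    have hdiv : L ^ w / (w.factorial : ℝ) ≤ Real.exp (ε * L) * (ε ^ w)⁻¹ := by
      rw [mul_pow] at hpf
      have : ε ^ w * (L ^ w / (w.factorial : ℝ)) ≤ Real.exp (ε * L) := by
        simpa [mul_div_assoc] using hpf
      calc L ^ w / (w.factorial : ℝ) = (ε ^ w)⁻¹ * (ε ^ w * (L ^ w / (w.factorial : ℝ))) := by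
            field_simp
        _ ≤ (ε ^ w)⁻¹ * Real.exp (ε * L) := mul_le_mul_of_nonneg_left this (inv_nonneg.mpr hεw.le)
        _ = Real.exp (ε * L) * (ε ^ w)⁻¹ := mul_comm _ _
    have hinv : (ε ^ w)⁻¹ = Real.exp ((w : ℝ) * ((1 - θ') * Real.log L)) := by
      rw [hε, ← Real.exp_nat_mul, ← Real.exp_neg]
      congr 1; ring
    have hexp_eq : Real.exp (ε * L) * (ε ^ w)⁻¹
        = Real.exp (L ^ θ' + (w : ℝ) * ((1 - θ') * Real.log L)) := by
      rw [hinv, ← Real.exp_add, hεL]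
    -- the exponent is `≤ (K + 1 + 1/(θ-θ')) L^θ - log κ`, indeed `≤ A₁ L^θ - log κ`
    have hLθ'θ : L ^ θ' ≤ L ^ θ := Real.rpow_le_rpow_of_exponent_le hL1 h1.le
    have h1Lθ : 1 ≤ L ^ θ := Real.one_le_rpow hL1 hθ0.le
    have hLθ' : 0 ≤ L ^ θ' := Real.rpow_nonneg hL0.le _
    have hlogLb : L ^ θ' * Real.log L ≤ L ^ θ / (θ - θ') := by
      have hl : Real.log L ≤ L ^ (θ - θ') / (θ - θ') := Real.log_le_rpow_div hL0.le hgap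
      calc L ^ θ' * Real.log L ≤ L ^ θ' * (L ^ (θ - θ') / (θ - θ')) :=
            mul_le_mul_of_nonneg_left hl hLθ'
        _ = L ^ θ' * L ^ (θ - θ') / (θ - θ') := (mul_div_assoc _ _ _).symm
        _ = L ^ θ / (θ - θ') := by rw [← Real.rpow_add hL0]; ring_nf
    have hx : (1 - θ') * Real.log L ≤ Real.log L := by nlinarith
    have hx0 : 0 ≤ (1 - θ') * Real.log L := mul_nonneg (by linarith) hlogL
    have hwlog : (w : ℝ) * ((1 - θ') * Real.log L) ≤ L ^ θ / (θ - θ') := by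
      calc (w : ℝ) * ((1 - θ') * Real.log L) ≤ L ^ θ' * ((1 - θ') * Real.log L) :=
            mul_le_mul_of_nonneg_right hw hx0
        _ ≤ L ^ θ' * Real.log L := mul_le_mul_of_nonneg_left hx hLθ'
        _ ≤ L ^ θ / (θ - θ') := hlogLb
    have hKθ : Real.log κ ≤ K * L ^ θ :=
      calc Real.log κ ≤ K := hlogκ
        _ = K * 1 := (mul_one _).symm
        _ ≤ K * L ^ θ := mul_le_mul_of_nonneg_left h1Lθ hK0
    have hsum : Real.log κ + (L ^ θ' + (w : ℝ) * ((1 - θ') * Real.log L)) ≤ A₁ * L ^ θ := by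
      have e : A₁ * L ^ θ = (K + 1) / Real.log 2 ^ θ * L ^ θ + K * L ^ θ + L ^ θ
          + 1 / (θ - θ') * L ^ θ := by rw [hA₁]; ring
      rw [e]
      have hq : 0 ≤ (K + 1) / Real.log 2 ^ θ * L ^ θ := mul_nonneg hq0 hLθ0.le
      have hg : (w : ℝ) * ((1 - θ') * Real.log L) ≤ 1 / (θ - θ') * L ^ θ := by
        rw [one_div_mul_eq_div]; exact hwlog
      linarith
    calc κ * (L ^ w / (w.factorial : ℝ)) ≤ κ * (Real.exp (ε * L) * (ε ^ w)⁻¹) :=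
          mul_le_mul_of_nonneg_left hdiv hκ.le
      _ = Real.exp (Real.log κ) * Real.exp (L ^ θ' + (w : ℝ) * ((1 - θ') * Real.log L)) := by
          rw [hexp_eq, Real.exp_log hκ]
      _ = Real.exp (Real.log κ + (L ^ θ' + (w : ℝ) * ((1 - θ') * Real.log L))) :=
          (Real.exp_add _ _).symm
      _ ≤ Real.exp (A₁ * L ^ θ) := Real.exp_le_exp.mpr hsum
  · -- `L < 1`: `L^w/w! ≤ e^L < e`, so the bracket is `< κ e ≤ exp((K+1)/(log 2)^θ · L^θ)`
    have hpf : L ^ w / (w.factorial : ℝ) ≤ Real.exp L := Real.pow_div_factorial_le_exp L hL0.le w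
    have hexp1 : Real.exp L ≤ Real.exp 1 := Real.exp_le_exp.mpr hL1.le
    have hK1 : K + 1 ≤ (K + 1) / Real.log 2 ^ θ * L ^ θ := by
      rw [div_mul_eq_mul_div, le_div_iff₀ hl2θ]
      exact mul_le_mul_of_nonneg_left hLθ2 (by linarith)
    have hA₁ge : (K + 1) / Real.log 2 ^ θ * L ^ θ ≤ A₁ * L ^ θ := by
      apply mul_le_mul_of_nonneg_right _ hLθ0.le
      rw [hA₁]; linarith
    calc κ * (L ^ w / (w.factorial : ℝ)) ≤ κ * Real.exp 1 :=
          mul_le_mul_of_nonneg_left (hpf.trans hexp1) hκ.le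
      _ = Real.exp (Real.log κ + 1) := by rw [Real.exp_add, Real.exp_log hκ]
      _ ≤ Real.exp (A₁ * L ^ θ) := Real.exp_le_exp.mpr (by linarith)

/-- **The ω-split composes to a sub-power slack.**  Baker's refinement with SOME constant
(`∃ κ, BakerShapeExplicitABC κ` — route LogCardinality's item `BakerRefinement`, stmt-ABC-1756, taken as
a hypothesis) on the few-primes triples `ω(abc) ≤ (log N)^{θ'}`, together with an ASSUMED sub-power
excess on the ultra-composite tail `ω(abc) > (log N)^{θ'}` (`0 < θ' < θ < 1`), give the pointwise
sub-power slack `∃ τ < 1, ∃ A, ∀ abc triples, c < rad · exp(A (log rad)^τ)` (with `τ = θ`).  The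
`a < b` normalisation of Baker's shape is removed by the symmetry `(a,b,c) ↦ (b,a,c)`; `a = b` forces
the triple `(1,1,2)`, where `c = 2 ≤ rad`. [cite: BombieriGubler2006, Conj. 12.2.6] -/
theorem Target.subPowerSlack_of_bakerShape_of_tail
    (hB : ∃ κ : ℝ, Literature.Barriers.ABC.BakerShapeExplicitABC κ)
    (hT : ∃ θ' θ : ℝ, 0 < θ' ∧ θ' < θ ∧ θ < 1 ∧ ∃ A : ℝ, ∀ a b c : ℕ, IsABCTriple a b c →
      Real.log ((rad a b c : ℕ) : ℝ) ^ θ' < ((ArithmeticFunction.cardDistinctFactors (a * b * c) : ℕ) : ℝ) →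
      (c : ℝ) < ((rad a b c : ℕ) : ℝ) * Real.exp (A * Real.log ((rad a b c : ℕ) : ℝ) ^ θ)) :
    ∃ τ : ℝ, τ < 1 ∧ ∃ A : ℝ, ∀ a b c : ℕ, IsABCTriple a b c →
      (c : ℝ) < ((rad a b c : ℕ) : ℝ) * Real.exp (A * Real.log ((rad a b c : ℕ) : ℝ) ^ τ) := by
  obtain ⟨κ, hκB⟩ := hB
  obtain ⟨θ', θ, h0, h1, h2, AT, hT⟩ := hT
  have hθ0 : 0 < θ := h0.trans h1
  have hgap : 0 < θ - θ' := by linarith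
  -- `κ > 0`, from Baker's shape at the triple `(1, 2, 3)`
  have hκ : 0 < κ := by
    have h123 : IsABCTriple 1 2 3 := ⟨by norm_num, by norm_num, by norm_num, by norm_num⟩
    have hb := hκB 1 2 3 h123 (by norm_num)
    by_contra hneg
    rw [not_lt] at hneg
    have hpos : 0 ≤ ((rad 1 2 3 : ℕ) : ℝ) * Real.log ((rad 1 2 3 : ℕ) : ℝ)
        ^ (ArithmeticFunction.cardDistinctFactors (1 * 2 * 3))
        / ((ArithmeticFunction.cardDistinctFactors (1 * 2 * 3)).factorial : ℝ) := by
      have hr1 : (1 : ℝ) ≤ ((rad 1 2 3 : ℕ) : ℝ) := by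
        exact_mod_cast le_trans (by norm_num) (SubmultOfRST.two_le_rad h123)
      have : 0 ≤ Real.log ((rad 1 2 3 : ℕ) : ℝ) := Real.log_nonneg hr1
      positivity
    have : ((3 : ℕ) : ℝ) < 0 := by
      calc ((3 : ℕ) : ℝ) < κ * ((rad 1 2 3 : ℕ) : ℝ) * Real.log ((rad 1 2 3 : ℕ) : ℝ)
            ^ (ArithmeticFunction.cardDistinctFactors (1 * 2 * 3))
            / ((ArithmeticFunction.cardDistinctFactors (1 * 2 * 3)).factorial : ℝ) := hb
        _ = κ * (((rad 1 2 3 : ℕ) : ℝ) * Real.log ((rad 1 2 3 : ℕ) : ℝ)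
            ^ (ArithmeticFunction.cardDistinctFactors (1 * 2 * 3))
            / ((ArithmeticFunction.cardDistinctFactors (1 * 2 * 3)).factorial : ℝ)) := by ring
        _ ≤ 0 := mul_nonpos_of_nonpos_of_nonneg hneg hpos
    have h3 : (0 : ℝ) ≤ ((3 : ℕ) : ℝ) := Nat.cast_nonneg 3
    linarith
  set A₁ : ℝ := (|Real.log κ| + 1) / Real.log 2 ^ θ + |Real.log κ| + 1 + 1 / (θ - θ') with hA₁
  have hlog2 : 0 < Real.log 2 := Real.log_pos one_lt_two
  have hl2θ : 0 < Real.log 2 ^ θ := Real.rpow_pos_of_pos hlog2 _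
  have hA₁0 : 0 < A₁ := by
    have : 0 ≤ (|Real.log κ| + 1) / Real.log 2 ^ θ := div_nonneg (by positivity) hl2θ.le
    have : 0 < 1 / (θ - θ') := div_pos one_pos hgap
    rw [hA₁]; positivity
  refine ⟨θ, h2, max AT A₁, ?_⟩
  intro a b c habc
  have hrad2 : (2 : ℝ) ≤ ((rad a b c : ℕ) : ℝ) := by exact_mod_cast SubmultOfRST.two_le_rad habc
  have hrad0 : (0 : ℝ) < ((rad a b c : ℕ) : ℝ) := by linarith
  set L : ℝ := Real.log ((rad a b c : ℕ) : ℝ) with hLdef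
  have hL0 : 0 < L := hlog2.trans_le (Real.log_le_log two_pos hrad2)
  have hLθ0 : 0 ≤ L ^ θ := Real.rpow_nonneg hL0.le _
  have hmonoT : ((rad a b c : ℕ) : ℝ) * Real.exp (AT * L ^ θ)
      ≤ ((rad a b c : ℕ) : ℝ) * Real.exp (max AT A₁ * L ^ θ) :=
    mul_le_mul_of_nonneg_left
      (Real.exp_le_exp.mpr (mul_le_mul_of_nonneg_right (le_max_left _ _) hLθ0)) hrad0.le
  have hmono₁ : ((rad a b c : ℕ) : ℝ) * Real.exp (A₁ * L ^ θ)
      ≤ ((rad a b c : ℕ) : ℝ) * Real.exp (max AT A₁ * L ^ θ) :=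
    mul_le_mul_of_nonneg_left
      (Real.exp_le_exp.mpr (mul_le_mul_of_nonneg_right (le_max_right _ _) hLθ0)) hrad0.le
  set w : ℕ := ArithmeticFunction.cardDistinctFactors (a * b * c) with hw
  rcases lt_or_ge (L ^ θ') (w : ℝ) with hlarge | hsmall
  · -- MANY primes: the tail hypothesis
    exact (hT a b c habc hlarge).trans_le hmonoT
  · -- FEW primes: Baker's shape, for the normalised triple `x < y`
    have key : ∀ x y : ℕ, IsABCTriple x y c → x < y → rad x y c = rad a b c →
        ArithmeticFunction.cardDistinctFactors (x * y * c) = w →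
        (c : ℝ) < ((rad a b c : ℕ) : ℝ) * Real.exp (A₁ * L ^ θ) := by
      intro x y hxy hlt hradxy hwxy
      have hb := hκB x y c hxy hlt
      rw [hradxy, hwxy] at hb
      exact Target.smallOmega_bound hκ h0 h1 h2 hrad2 hsmall hb
    obtain ⟨ha, hb, habc', hcop⟩ := habc
    rcases lt_trichotomy a b with hlt | heq | hgt
    · exact (key a b ⟨ha, hb, habc', hcop⟩ hlt rfl rfl).trans_le hmono₁
    · -- `a = b = 1`, `c = 2 ≤ rad < rad · exp(positive)`
      subst heq
      have ha1 : a = 1 := (Nat.coprime_self a).mp hcop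
      subst ha1
      have hc2 : (c : ℝ) = 2 := by exact_mod_cast (show c = 2 by omega)
      have hpos : 0 < max AT A₁ * L ^ θ :=
        mul_pos (hA₁0.trans_le (le_max_right _ _)) (Real.rpow_pos_of_pos hL0 _)
      have h1lt : (1 : ℝ) < Real.exp (max AT A₁ * L ^ θ) := Real.one_lt_exp_iff.mpr hpos
      calc (c : ℝ) = 2 := hc2
        _ ≤ ((rad 1 1 c : ℕ) : ℝ) := hrad2
        _ = ((rad 1 1 c : ℕ) : ℝ) * 1 := (mul_one _).symm
        _ < ((rad 1 1 c : ℕ) : ℝ) * Real.exp (max AT A₁ * L ^ θ) := mul_lt_mul_of_pos_left h1lt hrad0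
    · -- `b < a`: Baker's shape for the swapped triple `(b, a, c)`
      have hsym : IsABCTriple b a c := ⟨hb, ha, by omega, hcop.symm⟩
      have hradsym : rad b a c = rad a b c := by rw [rad_def, rad_def, mul_comm b a]
      have hwsym : ArithmeticFunction.cardDistinctFactors (b * a * c) = w := by rw [hw, mul_comm b a]
      exact (key b a hsym hgt hradsym hwsym).trans_le hmono₁

/-- **The ω-split line concludes the crux `Target` by name** (stmt-ABC-2159, route `FeketeScales`):
Baker's refinement with some constant (route LogCardinality's `BakerRefinement`, stmt-ABC-1756) and a
sub-power excess on the ultra-composite tail `ω(abc) > (log rad)^{θ'}`, `0 < θ' < θ < 1`, imply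
`Target`, via `Target.subPowerSlack_of_bakerShape_of_tail` and `Target.target_of_subPowerSlack`.
Both hypotheses are conjecture-grade and are taken as hypotheses: this theorem is the line's GLUE,
it closes nothing. [cite: BombieriGubler2006, Conj. 12.2.6] -/
theorem Target.target_of_bakerShape_of_tail
    (hB : ∃ κ : ℝ, Literature.Barriers.ABC.BakerShapeExplicitABC κ)
    (hT : ∃ θ' θ : ℝ, 0 < θ' ∧ θ' < θ ∧ θ < 1 ∧ ∃ A : ℝ, ∀ a b c : ℕ, IsABCTriple a b c →
      Real.log ((rad a b c : ℕ) : ℝ) ^ θ' < ((ArithmeticFunction.cardDistinctFactors (a * b * c) : ℕ) : ℝ) →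
      (c : ℝ) < ((rad a b c : ℕ) : ℝ) * Real.exp (A * Real.log ((rad a b c : ℕ) : ℝ) ^ θ)) :
    Target :=
  Target.target_of_subPowerSlack (Target.subPowerSlack_of_bakerShape_of_tail hB hT)

end Summit.ABC.ABC.Theorems
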